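/-
Copyright (c) 2026 the pub-hodgecm-mathlib formalisation cell (harness21).  Prover seat hodgecm-mathlib-LH4-p18 (g4), req620 Track A «(D-RAM) FOUR-FRAME» squad
(STAGE-1b, row (2) of the piece `f_{T₊}`, the (β₂) road (R-36) «PURE-CELL LEDGER»; K6 desk LH4-p16 (g3) WORD #1 (c) ∕ #2 (α) ∕ #11; F2a = the two digit reads of the FLIP CELL
that the ‹FLIPVAL.letter.v1› payer needs on top of ★ F1b p864627), 2026-09-05.
-/
import Summits.HodgeConjecture.HodgeConjecture.Theorems.F0P3cDyRamRowCellDigitClassTwist        -- ★ (LH7-p08 (g3)): `classClause_iff_of_near`; brings ★ p863859 `fixedNorm_mul ∕ fixedNorm_inv`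
import Summits.HodgeConjecture.HodgeConjecture.Theorems.F0P3cDyRamOneChartDigitTotals            -- ★ p864509 (LH7-p06 (g3)): `card_filter_level_eq`, `card_filter_ball_eq`
import Summits.HodgeConjecture.HodgeConjecture.Theorems.F0P3cDyRamWindowLabelSumVanishes         -- ★ p864489 (LH4-p11 (g11)): `sum_normSign_affine_ballSystem_eq_zero`
import Literature.NumberTheory.LocalFields.WildQuadraticDatumNormSignConductor                 -- ★ Lit: `normSign_eq_of_near`
import HarnessLib

/-!
# Crux `H413`, line LH4 «(D-RAM) FOUR-FRAME» — STAGE-1b, row (2), the (β₂) road (R-36), K6 road F2a: «THE TWO DIGIT READS OF THE FLIP CELL» — (§1) on the FAR shell the class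
# conjunct of ★ p863983's `LIT` does not depend on the unit digit (general line model `(φ, h)`); (§2) at `d = 2`, over a σ-fixed integral digit system modulo `|ϖ|^4`, the unit
# digits number `(q − 1)·q` and their affine label signs sum to `−q·ω(α₁)`

Cell `hodgecm-mathlib` (D-0151), FLOOR 0, crux item H413 = `stmt-HodgeConjecture-24833`, route of record `HCCMUnconditional`; squad F0∕P3c∕LH4; lane
`--supports stmt-HodgeConjecture-24833 --as helper` (count-neutral; pays NO tier-0 row).  THEOREMS ONLY (no `def`, no instance, no notation, no `sorry`, default heartbeats);
★-only imports; states NO law; (β₂) stays a HYPOTHESIS.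
WHAT.  §1 `classClause_iff_of_units_far`: `jE`-letters on a complete `E` with the wild datum, `ρ² = 1` isometric commuting with `Θ`, a `Θ`-fixed base point `κ₀` with `|κ₀| ≤ 1`, a
`Θ`-fixed direction `ξ₀` on a FAR shell (`1 ≤ |jEϖ|^{2d−1}·|ξ₀|`), any scalar `c`; two `σ`-fixed UNIT digits `V, V′`.  THEN `(∃ e, ρe = e ∧ eΘe = Q(V)∕c) ↔ (∃ e, ρe = e ∧ eΘe = Q(V′)∕c)`,
`Q(V) = (κ₀ + jE V·ξ₀)·ρ(κ₀ + jE V·ξ₀)` — ★ p863983's class conjunct in its bytes at `c := hρh`.  MECHANISM: the rescaled point `κ″ = (jEV∕jEV′)·(κ₀ + jEV′ξ₀)` is `Θ`-fixed and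
`|κ″ − (κ₀ + jEVξ₀)| = |jEV∕jEV′ − 1|·|κ₀| ≤ 1 ≤ |jEϖ|^{2d−1}·|κ₀ + jEVξ₀|`, so ★ `classClause_iff_of_near` (LH7-p08) identifies the classes of `κ″` and `κ₀ + jEVξ₀`; and
`Q(κ″) = Q(V′)·N_Θ(jEV∕jEV′)` with `jEV∕jEV′ ∈ Fix ρ` (★ p863859 `fixedNorm_mul ∕ fixedNorm_inv`).  §2 `card_unitDigits_and_sum_normSign_affine` (`K`-side, the datum AT `d = 2`,
`|2| < 1`): `α₁, γ₁` fixed with `|α₁| = 1`, `|γ₁| = |ϖ|²`; `Rd` fixed integral digits, complete and irredundant modulo `|ϖ|^4`.  THEN `#(Rd.filter (|·| = 1)) = (q − 1)·q` and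
`Σ_{V ∈ Rd, |V| = 1} ω(α₁ + γ₁V) = −q·ω(α₁)` (`q = #𝓀[K]`): the whole system sums to `0` (★ p864489 at `R = 1`, `r = |ϖ|^4`), the `q` non-unit digits (★ p864509: the ball
`|V| ≤ |ϖ|²`) each read `ω(α₁)` (★ Lit `normSign_eq_of_near`, `|γ₁V| ≤ |ϖ|^4 ≤ |ϖ|^3`), and the unit shell has `(q − 1)·q` digits (★ p864509).
WHAT IS NOT CLAIMED: anything at `d ≠ 2` in §2; any census identity; ‹FLIPVAL› itself (F2b, next file).
HONEST LABEL.  Count-neutral reads of ★ pieces; no law is stated; `HC_CM` is proved only modulo the 7 printed citations (2 remaining named inputs: hLiu418 =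
`stmt-HodgeConjecture-24832`, h413 = `stmt-HodgeConjecture-24833`) until rung 0 closes.
## References
* [Serre1979] J.-P. Serre, *Local Fields*, GTM 67 (1979): Ch. V §3 Prop. 5, Cor. 2–3 pp. 84–86 (norm residue symbol, conductor); Ch. XV §2; Ch. IV §2 Prop. 6 (residue counting).
* [LabesseLanglands1979] J.-P. Labesse, R. P. Langlands, *L-indistinguishability for SL(2)*, Canad. J. Math. 31 (1979): §2 (2.2) p. 9 (κ-signed counts).
* [Kottwitz1986BaseChangeUnits] R. E. Kottwitz, *Base change for unit elements of Hecke algebras*, Compositio Math. 60 (1986): §1 pp. 240–241.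
-/

set_option autoImplicit false

noncomputable section

namespace Summit.HodgeConjecture.HodgeConjecture.Cruxes.H413.F0P3cDyRamFlipCellDigitReads

open scoped Valued WithZero Classical
open WithZero Finset
open Literature.NumberTheory.Automorphic.UnitaryThreeFourFrame (IsRamifiedQuadraticDatum normSign)
open Literature.NumberTheory.LocalFields.WildQuadraticDatum (normSign_eq_of_near)
open Summit.HodgeConjecture.HodgeConjecture.Cruxes.H413.F0P3cDyRamRowVertexPopulationRead (fixedNorm_mul fixedNorm_inv)
open Summit.HodgeConjecture.HodgeConjecture.Cruxes.H413.F0P3cDyRamRowCellDigitClassTwist (classClause_iff_of_near)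
open Summit.HodgeConjecture.HodgeConjecture.Cruxes.H413.F0P3cDyRamOneChartDigitTotals (card_filter_level_eq card_filter_ball_eq)
open Summit.HodgeConjecture.HodgeConjecture.Cruxes.H413.F0P3cDyRamWindowLabelSumVanishes (sum_normSign_affine_ballSystem_eq_zero)

variable {E M : Type} [Field E] [Valued E ℤᵐ⁰] [Field M] [Valued M ℤᵐ⁰] {ρ Θ : M →+* M}

/-! ## §1 On the far shell the class conjunct does not see the unit digit -/

/-- **FAR SHELL: THE CLASS CONJUNCT IS THE SAME AT ANY TWO UNIT DIGITS** (general line model: only the scalar `c` enters).  `jE`-letters on a complete `E` with the wild datum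
`IsRamifiedQuadraticDatum σ ϖ d tE` (`Fix ρ = jE(E)`, `Θ∘jE = jE∘σ`, `|jE a| = |a|`), `ρ² = 1` isometric, `Θρ = ρΘ`; `Θκ₀ = κ₀`, `|κ₀| ≤ 1`, `Θξ₀ = ξ₀` with `1 ≤ |jEϖ|^{2d−1}·|ξ₀|`;
`σ`-fixed `V, V′` with `|V| = |V′| = 1`.  THEN `(∃ e, ρe = e ∧ eΘe = Q(V)∕c) ↔ (∃ e, ρe = e ∧ eΘe = Q(V′)∕c)`, `Q(V) = (κ₀ + jEV·ξ₀)·ρ(κ₀ + jEV·ξ₀)`.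
[cite: Serre1979, Ch. V §3 Prop. 5, Cor. 2–3 pp. 84–86; Ch. XV §2] [cite: LabesseLanglands1979, §2 (2.2) p. 9] -/
theorem classClause_iff_of_units_far [CompleteSpace E] {σ : E →+* E} {ϖ : E} {d tE : ℕ} (hD : IsRamifiedQuadraticDatum σ ϖ d tE)
    (jE : E →+* M) (hjfix : ∀ z, ρ z = z ↔ ∃ c, jE c = z) (hΘj : ∀ c, Θ (jE c) = jE (σ c)) (hjiso : ∀ a, Valued.v (jE a) = Valued.v a)
    (hρρ : ∀ x, ρ (ρ x) = x) (hvρ : ∀ x, Valued.v (ρ x) = Valued.v x) (hΘρ : ∀ x, Θ (ρ x) = ρ (Θ x)) (c : M)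
    {κ₀ ξ₀ : M} (hΘκ₀ : Θ κ₀ = κ₀) (hκ₀1 : Valued.v κ₀ ≤ 1) (hΘξ : Θ ξ₀ = ξ₀) (hfar : 1 ≤ Valued.v (jE ϖ) ^ (2 * d - 1) * Valued.v ξ₀)
    {V V' : E} (hσV : σ V = V) (hV1 : Valued.v V = 1) (hσV' : σ V' = V') (hV'1 : Valued.v V' = 1) :
    (∃ e : M, ρ e = e ∧ e * Θ e = (κ₀ + jE V * ξ₀) * ρ (κ₀ + jE V * ξ₀) / c) ↔
      ∃ e : M, ρ e = e ∧ e * Θ e = (κ₀ + jE V' * ξ₀) * ρ (κ₀ + jE V' * ξ₀) / c := by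
  obtain ⟨-, -, hϖ, -, -, hd1, -⟩ := id hD
  have hρj : ∀ a : E, ρ (jE a) = jE a := fun a => (hjfix _).2 ⟨a, rfl⟩
  have hjϖlt : Valued.v (jE ϖ) < 1 := by rw [hjiso, hϖ, ← exp_zero, exp_lt_exp]; norm_num
  -- the far shell lies outside the unit ball
  have hξ1 : 1 < Valued.v ξ₀ := by
    by_contra hle
    have hlt : Valued.v (jE ϖ) ^ (2 * d - 1) * Valued.v ξ₀ < 1 :=
      calc Valued.v (jE ϖ) ^ (2 * d - 1) * Valued.v ξ₀ ≤ Valued.v (jE ϖ) ^ (2 * d - 1) * 1 := mul_le_mul' le_rfl (not_lt.1 hle)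
        _ < 1 := by rw [mul_one]; exact pow_lt_one₀ zero_le hjϖlt (by omega)
    exact absurd hfar (not_le.2 hlt)
  have hx1 : Valued.v (jE V) = 1 := by rw [hjiso, hV1]
  have hx'1 : Valued.v (jE V') = 1 := by rw [hjiso, hV'1]
  have hx0 : jE V ≠ 0 := fun h0 => by rw [h0, map_zero] at hx1; exact zero_ne_one hx1
  have hx'0 : jE V' ≠ 0 := fun h0 => by rw [h0, map_zero] at hx'1; exact zero_ne_one hx'1
  have hΘx : Θ (jE V) = jE V := by rw [hΘj, hσV]
  have hΘx' : Θ (jE V') = jE V' := by rw [hΘj, hσV']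
  -- the point `κ = κ₀ + jEV·ξ₀` has `|κ| = |ξ₀|`
  have hκv : Valued.v (κ₀ + jE V * ξ₀) = Valued.v ξ₀ := by
    have hlt : Valued.v κ₀ < Valued.v (jE V * ξ₀) := by rw [Valuation.map_mul, hx1, one_mul]; exact lt_of_le_of_lt hκ₀1 hξ1
    rw [Valuation.map_add_eq_of_lt_right _ hlt, Valuation.map_mul, hx1, one_mul]
  have hκ0 : κ₀ + jE V * ξ₀ ≠ 0 := fun h0 => by
    rw [h0, map_zero] at hκv; exact (lt_irrefl (0 : ℤᵐ⁰)) (lt_trans zero_lt_one (hκv ▸ hξ1))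
  -- the rescaled point `κ″ = (jEV∕jEV′)·(κ₀ + jEV′·ξ₀)` is `Θ`-fixed and `|ϖE|^{2d−1}`-near `κ` relative to `|κ|`
  have hΘκ : Θ (κ₀ + jE V * ξ₀) = κ₀ + jE V * ξ₀ := by rw [map_add, map_mul, hΘκ₀, hΘx, hΘξ]
  have hΘκ'' : Θ (jE V / jE V' * (κ₀ + jE V' * ξ₀)) = jE V / jE V' * (κ₀ + jE V' * ξ₀) := by
    rw [map_mul, map_div₀, map_add, map_mul, hΘx, hΘx', hΘκ₀, hΘξ]
  have hnear : Valued.v (jE V / jE V' * (κ₀ + jE V' * ξ₀) - (κ₀ + jE V * ξ₀)) ≤ Valued.v (jE ϖ) ^ (2 * d - 1) * Valued.v (κ₀ + jE V * ξ₀) := by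
    have e : jE V / jE V' * (κ₀ + jE V' * ξ₀) - (κ₀ + jE V * ξ₀) = (jE V / jE V' - 1) * κ₀ := by field_simp; ring
    rw [e, hκv, Valuation.map_mul]
    have h1 : Valued.v (jE V / jE V' - 1) ≤ 1 :=
      (Valuation.map_sub _ _ _).trans (max_le (by rw [map_div₀, hx1, hx'1, div_one]) (by rw [Valuation.map_one]))
    calc Valued.v (jE V / jE V' - 1) * Valued.v κ₀ ≤ 1 * 1 := mul_le_mul' h1 hκ₀1
      _ = 1 := one_mul 1
      _ ≤ Valued.v (jE ϖ) ^ (2 * d - 1) * Valued.v ξ₀ := hfar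
  have h1 := classClause_iff_of_near hD jE hjfix hΘj hjiso hρρ hvρ hΘρ c hΘκ hΘκ'' hκ0 hnear
  -- `Q(κ″)∕c = (Q(V′)∕c)·N_Θ(jEV∕jEV′)` with `jEV∕jEV′ ∈ Fix ρ`
  have hN : jE V / jE V' * (κ₀ + jE V' * ξ₀) * ρ (jE V / jE V' * (κ₀ + jE V' * ξ₀)) / c =
      (κ₀ + jE V' * ξ₀) * ρ (κ₀ + jE V' * ξ₀) / c * (jE V / jE V' * Θ (jE V / jE V')) := by
    rw [map_mul ρ, map_div₀ ρ, hρj, hρj, map_div₀ Θ, hΘx, hΘx']; ring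
  have hsq : ∃ e : M, ρ e = e ∧ e * Θ e = jE V / jE V' * Θ (jE V / jE V') := ⟨jE V / jE V', by rw [map_div₀, hρj, hρj], rfl⟩
  have hsq0 : jE V / jE V' * Θ (jE V / jE V') ≠ 0 := by
    rw [map_div₀, hΘx, hΘx']; exact mul_ne_zero (div_ne_zero hx0 hx'0) (div_ne_zero hx0 hx'0)
  rw [← h1, hN]
  refine ⟨fun h => ?_, fun h => fixedNorm_mul h hsq⟩
  have h2 := fixedNorm_mul h (fixedNorm_inv hsq)
  rwa [mul_inv_cancel_right₀ hsq0] at h2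

/-! ## §2 At `d = 2`: the unit digits modulo `|ϖ|^4` — their number and their affine label sum -/

omit [Field M] [Valued M ℤᵐ⁰] in
/-- **THE UNIT DIGITS OF THE FLIP CELL (`d = 2`, resolution `|ϖ|^4`): `#(Rd.filter (|·| = 1)) = (q − 1)·q` AND `Σ_{V ∈ Rd, |V| = 1} ω(α₁ + γ₁V) = −q·ω(α₁)`.**  The datum AT
`d = 2` on a complete `K` with finite residue field, `|2| < 1`; `α₁, γ₁` fixed, `|α₁| = 1`, `|γ₁| = |ϖ|²`; `Rd` fixed integral, complete and irredundant modulo `|ϖ|^4` (`q = #𝓀[K]`).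
(★ p864489 at `R = 1`: the whole system sums to `0`; the non-units are the ball `|V| ≤ |ϖ|²` — `q` digits by ★ p864509 — and read `ω(α₁)` each by ★ Lit `normSign_eq_of_near`
(`|γ₁V| ≤ |ϖ|^4 ≤ |ϖ|^3`); the unit shell has `(q − 1)·q` digits by ★ p864509.) [cite: Serre1979, Ch. V §3 Cor. 3; Ch. XV §2; Ch. IV §2 Prop. 6] [cite: LabesseLanglands1979, §2 (2.2) p. 9] -/
theorem card_unitDigits_and_sum_normSign_affine [CompleteSpace E] [Finite 𝓀[E]] {σ : E →+* E} {ϖ : E} {tE : ℕ} (hD : IsRamifiedQuadraticDatum σ ϖ 2 tE)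
    (h2v : Valued.v (2 : E) < 1) {α₁ γ₁ : E} (hσα₁ : σ α₁ = α₁) (hα₁ : Valued.v α₁ = 1) (hσγ₁ : σ γ₁ = γ₁) (hγ₁ : Valued.v γ₁ = Valued.v ϖ ^ 2)
    (Rd : Finset E) (hRd1 : ∀ V ∈ Rd, σ V = V ∧ Valued.v V ≤ 1)
    (hRd2 : ∀ V : E, σ V = V → Valued.v V ≤ 1 → ∃ V₀ ∈ Rd, Valued.v (V - V₀) ≤ Valued.v ϖ ^ 4)
    (hRd3 : ∀ V ∈ Rd, ∀ V' ∈ Rd, Valued.v (V - V') ≤ Valued.v ϖ ^ 4 → V = V') :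
    (Rd.filter fun V => Valued.v V = 1).card = (Nat.card 𝓀[E] - 1) * Nat.card 𝓀[E] ∧
      ∑ V ∈ Rd.filter (fun V => Valued.v V = 1), normSign σ (α₁ + γ₁ * V) = -((Nat.card 𝓀[E] : ℤ) * normSign σ α₁) := by
  classical
  obtain ⟨-, -, hϖ, hfix, -, -, -⟩ := id hD
  have hϖn : ∀ n : ℕ, Valued.v ϖ ^ n = exp (-(n : ℤ)) := fun n => by rw [hϖ, ← exp_nsmul, nsmul_eq_mul, mul_neg, mul_one]
  have hϖ1 : Valued.v ϖ ≤ 1 := by rw [hϖ, ← exp_zero, exp_le_exp]; norm_num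
  have hϖlt : Valued.v ϖ < 1 := by rw [hϖ, ← exp_zero, exp_lt_exp]; norm_num
  -- the counts (★ p864509)
  have hU := card_filter_level_eq hD Rd hRd1 hRd2 hRd3 0 (by norm_num)
  have hB := card_filter_ball_eq hD Rd hRd1 hRd2 hRd3 1 (by norm_num)
  norm_num at hU hB
  -- the non-units of `Rd` are its ball of radius `|ϖ|²`
  have hNB : Rd.filter (fun V => ¬ Valued.v V = 1) = Rd.filter (fun V => Valued.v V ≤ Valued.v ϖ ^ 2) := by
    refine Finset.filter_congr fun V hV => ?_
    obtain ⟨hσV, hV1⟩ := hRd1 V hV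
    by_cases hV0 : V = 0
    · rw [hV0, Valuation.map_zero]; exact ⟨fun _ => zero_le, fun _ => zero_ne_one⟩
    · obtain ⟨n, hn⟩ := hfix V hσV hV0
      rw [hn, hϖn]
      rw [hn, ← exp_zero, exp_le_exp] at hV1
      refine ⟨fun hne => exp_le_exp.2 ?_, fun hle heq => ?_⟩
      · have hn0 : 2 * n ≠ 0 := fun h0 => hne (by rw [h0, exp_zero])
        push_cast; omega
      · have h0 : exp (0 : ℤ) ≤ exp (2 * n) := by rw [exp_zero, heq]
        have h1 := exp_le_exp.1 h0
        have h2 := exp_le_exp.1 hle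
        push_cast at h2; omega
  -- the whole system sums to zero (★ p864489 at `R = 1`, `r = |ϖ|^4`)
  have htot : ∑ V ∈ Rd, normSign σ (α₁ + γ₁ * V) = 0 := by
    refine sum_normSign_affine_ballSystem_eq_zero hD h2v hσα₁ hα₁ hσγ₁ (R := 1) (r := Valued.v ϖ ^ 4) ?_ ?_ (pow_ne_zero _ (by rw [hϖ]; exact exp_ne_zero)) ?_
      Rd hRd1 hRd2 hRd3
    · rw [mul_one, hγ₁]; exact pow_lt_one₀ zero_le hϖlt (by norm_num)
    · rw [mul_one, hγ₁, hϖn, exp_le_exp]; norm_num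
    · rw [hγ₁, ← pow_add]; exact pow_le_pow_right_of_le_one' hϖ1 (by norm_num)
  -- the non-units read `ω(α₁)` each
  have hcst : ∀ V ∈ Rd.filter (fun V => ¬ Valued.v V = 1), normSign σ (α₁ + γ₁ * V) = normSign σ α₁ := by
    intro V hV
    obtain ⟨hVR, -⟩ := Finset.mem_filter.1 hV
    rw [hNB] at hV
    have hV2 : Valued.v V ≤ Valued.v ϖ ^ 2 := (Finset.mem_filter.1 hV).2
    obtain ⟨hσV, -⟩ := hRd1 V hVR
    refine normSign_eq_of_near hD hσα₁ (by rw [map_add, map_mul, hσα₁, hσγ₁, hσV]) hα₁ (n := 2 * 2 - 1) le_rfl ?_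
    rw [show α₁ - (α₁ + γ₁ * V) = -(γ₁ * V) by ring, Valuation.map_neg, Valuation.map_mul, hγ₁]
    calc Valued.v ϖ ^ 2 * Valued.v V ≤ Valued.v ϖ ^ 2 * Valued.v ϖ ^ 2 := mul_le_mul' le_rfl hV2
      _ = Valued.v ϖ ^ 4 := by rw [← pow_add]
      _ ≤ Valued.v ϖ ^ (2 * 2 - 1) := pow_le_pow_right_of_le_one' hϖ1 (by norm_num)
  have hnon : ∑ V ∈ Rd.filter (fun V => ¬ Valued.v V = 1), normSign σ (α₁ + γ₁ * V) = (Nat.card 𝓀[E] : ℤ) * normSign σ α₁ := by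
    rw [Finset.sum_congr rfl hcst, Finset.sum_const, nsmul_eq_mul, hNB, hB]
  have hsplit := Finset.sum_filter_add_sum_filter_not Rd (fun V => Valued.v V = 1) (fun V => normSign σ (α₁ + γ₁ * V))
  rw [htot, hnon] at hsplit
  exact ⟨hU, by linarith⟩

end Summit.HodgeConjecture.HodgeConjecture.Cruxes.H413.F0P3cDyRamFlipCellDigitReads

end
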